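import Literature.NumberTheory.Automorphic.SchwartzBruhatL2Dense
import Literature.RepresentationTheory.Unitary.AdmissibleUnitarySemisimple
import Mathlib.Analysis.InnerProductSpace.LinearMap
import Mathlib.Analysis.InnerProductSpace.Subspace
import Mathlib.MeasureTheory.Function.L2Space
import HarnessLib

/-!
# `L²` orthogonal complements in `𝒮(X)` for conformally unitary admissible actions

Topic `NumberTheory/Automorphic`; namespace `Literature.NumberTheory.Automorphic.SchwartzBruhat` (that of the tree's
`SchwartzBruhat`, `SchwartzBruhatL2Norm.lean`, `SchwartzBruhatL2Dense.lean`).  KERNEL ONLY: theorems, 0 definitions,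
0 instances, 0 named facts, 0 `sorry`.

Let `X` be a topological space with a measure `ν` finite on compact sets and charging non-empty open sets, so that the
tree's embedding `SchwartzBruhat.toLp ν : 𝒮(X) →ₗ[ℂ] L²(X, ν)` (`SchwartzBruhatL2Dense.lean`) is injective
(`toLp_injective`, from `l2NormSq_pos`).  NO inner-product structure is put on `𝒮(X)` itself (no type synonym, no
instance): the `L²` pairing of two Schwartz–Bruhat functions is Mathlib's inner product of their classes in the Hilbert
space `Lp ℂ 2 ν`,
`⟪toLp ν Φ, toLp ν Ψ⟫ = ∫ conj Φ · Ψ dν` (`inner_toLp_toLp`, §1), and the **`L²`-orthogonal of a subspace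
`U ≤ 𝒮(X)` inside `𝒮(X)`** is spelled in Mathlib vocabulary as
`U' := (U.map (toLp ν))ᗮ.comap (toLp ν)`, i.e. `f ∈ U' ↔ ∀ u ∈ U, ∫ conj u · f dν = 0`
(`mem_comap_orthogonal_map_iff`, §2).

* §1 `inner_toLp_toLp`, `inner_toLp_self` (`= ‖Φ‖²_{L²}`), and POLARIZATION: a linear operator `T` of `𝒮(X)` with
  `‖T Φ‖²_{L²} = c ‖Φ‖²_{L²}` for all `Φ` (`c : ℝ≥0∞`, no side condition) is a SIMILITUDE of the pairing,
  `⟪T Φ, T Ψ⟫ = c ⟪Φ, Ψ⟫` (`inner_toLp_map_map_of_l2NormSq_eq_mul`, integral form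
  `integral_conj_mul_map_map_of_l2NormSq_eq_mul`; Mathlib's `inner_eq_sum_norm_sq_div_four`);
* §2 `U ⊓ U' = ⊥` (`inf_comap_orthogonal_map_eq_bot`) and: if a group `G` acts on `𝒮(X)` CONFORMALLY for `‖·‖²_{L²(ν)}`
  (`‖ρ(g)Φ‖² = c_g ‖Φ‖²`) and `U` is `G`-invariant, then so is `U'` (`rho_mem_comap_orthogonal_map`);
* §3 **`U ⊔ U' = ⊤`** (`sup_comap_orthogonal_map_eq_top_of_isAdmissible`) when `G` is a topological group with a compact
  open subgroup `K` acting `L²`-ISOMETRICALLY (`‖ρ(k)Φ‖² = ‖Φ‖²`, `k ∈ K` — unitarity is needed on `K` ONLY) and `ρ` is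
  ADMISSIBLE (tree `Representation.IsAdmissible`), for every `K`-invariant `U`.  This is the tree's
  `Unitary.sup_orthogonal_eq_top_of_isAdmissible` ([Bump1997, Prop. 4.2.5]; `Unitary/AdmissibleUnitarySemisimple.lean`,
  whose proof uses unitarity only on `K`) transported to the inner product space `V := range (toLp ν) ≤ L²(X, ν)`
  along `LinearEquiv.ofInjective`: the `K`-isometry becomes `K`-unitarity by `LinearMap.norm_map_iff_inner_map_map`,
  admissibility is transported along the equivariant equivalence, and `Semisimple.sup_orthogonal_eq_top_of_invariant`
  applies to `ρ|_K` with `Unitary.finiteDimensional_span_range_restrict` / `finiteDimensional_isotypicComponent_restrict`;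
* §4 the packaged statement `exists_orthogonal_compl_of_isAdmissible` (an invariant `U'` with the integral membership
  criterion, `U ⊓ U' = ⊥`, `U ⊔ U' = ⊤`) and complete reducibility
  `isSemisimpleRepresentation_of_isAdmissible_of_conformal`.

Use (cell `hodgecm-mathlib`, fan B, node H7 of B-p02's route R6 «doubling + density» for
`MoeglinVignerasWaldspurger1987.mvw_IV4_rankOne_irreducibleOrZero`, [Howe1979 §11] made explicit): the local Weil
representation restricted to `U(V)(F_v)` is conformally `L²`-isometric for every splitting and `L²`-isometric on compact
subgroups (`GelbartRogawski1991/LocalSplittingConformallyIsometric.lean`: `exists_l2NormSq_toRep_comp_eq_mul`,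
`l2NormSq_toRep_comp_eq_of_mem_compact` — exactly the hypotheses `hconf`, `hKiso` below) and admissible, so a proper
invariant subspace `A` of `Θ(χ)` splits it as `A ⊕ A'` with `⟪ω(g) f₁, f₂⟫ = 0` for `f₁ ∈ A`, `f₂ ∈ A'`.  Nothing about Weil
representations is asserted here.

## References
* [Bump1997] D. Bump, *Automorphic forms and representations*, CUP 1997, Prop. 4.2.5 (admissible unitary ⇒ completely
  reducible; the proof uses the compact open subgroup only).
* [BernsteinZelevinsky1976] I. N. Bernstein, A. V. Zelevinsky, Russian Math. Surveys 31 (1976), §2.1 (admissible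
  representations; unitarisable admissible representations are completely reducible).
* [Weil1964] A. Weil, *Sur certains groupes d'opérateurs unitaires*, Acta Math. 111 (1964), Chap. I n° 11–13
  (`𝒮(X) ⊂ L²(X)`, unitarity of the metaplectic operators).
-/

set_option autoImplicit false

noncomputable section

open _root_.MeasureTheory _root_.MeasureTheory.Measure Set
open scoped ENNReal NNReal InnerProductSpace ComplexConjugate

namespace Literature.NumberTheory.Automorphic

namespace SchwartzBruhat

/-! ## §0 Admissibility along an equivariant linear equivalence -/

section Transport

variable {G : Type*} [Group G] [TopologicalSpace G] {S V : Type*} [AddCommGroup S] [Module ℂ S]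
  [AddCommGroup V] [Module ℂ V]

/-- admissibility is transported along an equivariant linear equivalence (same topological group): stabilisers
correspond, and `V^K = e(S^K)`.  (The tree proves this as `Representation.IsAdmissible.of_equivariant` in
`TwistedCoinvariantsCentralCharacterQuotient.lean`; re-derived here privately to keep the import cone to
`SchwartzBruhatL2Dense` + `Unitary/AdmissibleUnitarySemisimple`.) [cite: BernsteinZelevinsky1976, §2.1] -/
private theorem isAdmissible_of_equivariant {ρ : Representation ℂ G S} (ρ' : Representation ℂ G V)
    (e : S ≃ₗ[ℂ] V) (he : ∀ g v, e (ρ g v) = ρ' g (e v)) (h : ρ.IsAdmissible) : ρ'.IsAdmissible := by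
  refine ⟨fun v' => ?_, fun K hK => ?_⟩
  · obtain ⟨v, rfl⟩ := e.surjective v'
    have hstab : ρ'.stabilizerSubgroup (e v) = ρ.stabilizerSubgroup v := by
      ext g
      rw [Representation.mem_stabilizerSubgroup, Representation.mem_stabilizerSubgroup, ← he, e.injective.eq_iff]
    rw [Representation.isSmoothVector_iff, hstab]
    exact (Representation.isSmoothVector_iff _ _).1 (h.isSmooth v)
  · haveI := h.finite_fixedPoints K hK
    have hmap : (ρ.fixedPoints (K : Subgroup G)).map (e : S →ₗ[ℂ] V) = ρ'.fixedPoints (K : Subgroup G) := by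
      ext v'
      constructor
      · rintro ⟨v, hv, rfl⟩
        rw [SetLike.mem_coe, Representation.mem_fixedPoints] at hv
        rw [Representation.mem_fixedPoints]
        intro g hg
        rw [LinearEquiv.coe_coe, ← he, hv g hg]
      · intro hv'
        rw [Representation.mem_fixedPoints] at hv'
        refine ⟨e.symm v', ?_, e.apply_symm_apply v'⟩
        rw [SetLike.mem_coe, Representation.mem_fixedPoints]
        intro g hg
        apply e.injective
        rw [he, e.apply_symm_apply, hv' g hg]
    rw [← hmap]
    exact Module.Finite.map _ _

end Transport

variable {X : Type*} [TopologicalSpace X] [MeasurableSpace X] [OpensMeasurableSpace X] (ν : Measure X)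
  [IsFiniteMeasureOnCompacts ν]

/-! ## §1 The `L²` pairing of Schwartz–Bruhat functions through `toLp`; polarization -/

/-- **`⟪[Φ], [Ψ]⟫_{L²(ν)} = ∫ conj Φ · Ψ dν`**: Mathlib's inner product of the `L²` classes of two Schwartz–Bruhat functions
is the integral pairing of the functions (Mathlib's convention: conjugate-linear in the FIRST variable).
[cite: Weil1964, Chap. I n° 11] -/
theorem inner_toLp_toLp (Φ Ψ : SchwartzBruhat X) :
    ⟪toLp ν Φ, toLp ν Ψ⟫_ℂ = ∫ x, conj ((Φ : X → ℂ) x) * (Ψ : X → ℂ) x ∂ν := by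
  rw [MeasureTheory.L2.inner_def]
  refine integral_congr_ae ?_
  filter_upwards [coeFn_toLp ν Φ, coeFn_toLp ν Ψ] with x hΦ hΨ
  rw [hΦ, hΨ, RCLike.inner_apply']

/-- `⟪[Φ], [Φ]⟫ = ‖Φ‖²_{L²(ν)}` (the tree's `l2NormSq`, read in `ℂ`). [cite: Weil1964, Chap. I n° 11] -/
theorem inner_toLp_self (Φ : SchwartzBruhat X) :
    ⟪toLp ν Φ, toLp ν Φ⟫_ℂ = (((l2NormSq ν Φ).toReal : ℝ) : ℂ) := by
  rw [inner_self_eq_norm_sq_to_K, ← norm_toLp_sq]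
  norm_cast

/-- `∫ conj Φ · Φ dν = ‖Φ‖²_{L²(ν)}`. [cite: Weil1964, Chap. I n° 11] -/
theorem integral_conj_mul_self (Φ : SchwartzBruhat X) :
    ∫ x, conj ((Φ : X → ℂ) x) * (Φ : X → ℂ) x ∂ν = (((l2NormSq ν Φ).toReal : ℝ) : ℂ) := by
  rw [← inner_toLp_toLp, inner_toLp_self]

/-- an operator with `‖T Φ‖²_{L²} = c ‖Φ‖²_{L²}` scales the real norms of the classes: `‖[T Φ]‖² = c ‖[Φ]‖²`.
[cite: Weil1964, Chap. I n° 13] -/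
theorem norm_toLp_map_sq_of_l2NormSq_eq_mul (T : SchwartzBruhat X →ₗ[ℂ] SchwartzBruhat X) {c : ℝ≥0∞}
    (hT : ∀ Φ, l2NormSq ν (T Φ) = c * l2NormSq ν Φ) (Φ : SchwartzBruhat X) :
    ‖toLp ν (T Φ)‖ ^ 2 = c.toReal * ‖toLp ν Φ‖ ^ 2 := by
  rw [norm_toLp_sq, norm_toLp_sq, hT, ENNReal.toReal_mul]

/-- **POLARIZATION: a conformally `L²`-isometric operator is a similitude of the `L²` pairing.**  If a `ℂ`-linear operator
`T` of `𝒮(X)` satisfies `‖T Φ‖²_{L²(ν)} = c ‖Φ‖²_{L²(ν)}` for all `Φ` (`c : ℝ≥0∞`, no side condition), then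
`⟪[T Φ], [T Ψ]⟫ = c ⟪[Φ], [Ψ]⟫` — the inner product is a combination of the norms of `Φ ± Ψ`, `Φ ± iΨ`
(`inner_eq_sum_norm_sq_div_four`). [cite: Weil1964, Chap. I n° 13] -/
theorem inner_toLp_map_map_of_l2NormSq_eq_mul (T : SchwartzBruhat X →ₗ[ℂ] SchwartzBruhat X) {c : ℝ≥0∞}
    (hT : ∀ Φ, l2NormSq ν (T Φ) = c * l2NormSq ν Φ) (Φ Ψ : SchwartzBruhat X) :
    ⟪toLp ν (T Φ), toLp ν (T Ψ)⟫_ℂ = ((c.toReal : ℝ) : ℂ) * ⟪toLp ν Φ, toLp ν Ψ⟫_ℂ := by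
  have hsq : ∀ Θ : SchwartzBruhat X,
      ((‖toLp ν (T Θ)‖ : ℝ) : ℂ) ^ 2 = ((c.toReal : ℝ) : ℂ) * ((‖toLp ν Θ‖ : ℝ) : ℂ) ^ 2 := by
    intro Θ
    exact_mod_cast norm_toLp_map_sq_of_l2NormSq_eq_mul ν T hT Θ
  have h1 : toLp ν (T Φ) + toLp ν (T Ψ) = toLp ν (T (Φ + Ψ)) := by rw [map_add, map_add]
  have h2 : toLp ν (T Φ) - toLp ν (T Ψ) = toLp ν (T (Φ - Ψ)) := by rw [map_sub, map_sub]
  have h3 : toLp ν (T Φ) - (RCLike.I : ℂ) • toLp ν (T Ψ) = toLp ν (T (Φ - (RCLike.I : ℂ) • Ψ)) := by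
    rw [map_sub, map_smul, map_sub, map_smul]
  have h4 : toLp ν (T Φ) + (RCLike.I : ℂ) • toLp ν (T Ψ) = toLp ν (T (Φ + (RCLike.I : ℂ) • Ψ)) := by
    rw [map_add, map_smul, map_add, map_smul]
  have h1' : toLp ν Φ + toLp ν Ψ = toLp ν (Φ + Ψ) := by rw [map_add]
  have h2' : toLp ν Φ - toLp ν Ψ = toLp ν (Φ - Ψ) := by rw [map_sub]
  have h3' : toLp ν Φ - (RCLike.I : ℂ) • toLp ν Ψ = toLp ν (Φ - (RCLike.I : ℂ) • Ψ) := by rw [map_sub, map_smul]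
  have h4' : toLp ν Φ + (RCLike.I : ℂ) • toLp ν Ψ = toLp ν (Φ + (RCLike.I : ℂ) • Ψ) := by rw [map_add, map_smul]
  rw [inner_eq_sum_norm_sq_div_four, inner_eq_sum_norm_sq_div_four, h1, h2, h3, h4, h1', h2', h3', h4',
    RCLike.ofReal_eq_complex_ofReal, hsq, hsq, hsq, hsq]
  ring

/-- the same in integral form: `∫ conj (T Φ) · T Ψ dν = c ∫ conj Φ · Ψ dν`. [cite: Weil1964, Chap. I n° 13] -/
theorem integral_conj_mul_map_map_of_l2NormSq_eq_mul (T : SchwartzBruhat X →ₗ[ℂ] SchwartzBruhat X) {c : ℝ≥0∞}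
    (hT : ∀ Φ, l2NormSq ν (T Φ) = c * l2NormSq ν Φ) (Φ Ψ : SchwartzBruhat X) :
    ∫ x, conj ((T Φ : X → ℂ) x) * (T Ψ : X → ℂ) x ∂ν =
      ((c.toReal : ℝ) : ℂ) * ∫ x, conj ((Φ : X → ℂ) x) * (Ψ : X → ℂ) x ∂ν := by
  rw [← inner_toLp_toLp, ← inner_toLp_toLp, inner_toLp_map_map_of_l2NormSq_eq_mul ν T hT]

/-! ## §2 The `L²`-orthogonal `U' = (U.map toLp)ᗮ.comap toLp` of a subspace of `𝒮(X)` -/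

/-- **membership in the `L²`-orthogonal**: `f ∈ (U.map (toLp ν))ᗮ.comap (toLp ν) ↔ ∀ u ∈ U, ∫ conj u · f dν = 0`.
[cite: Weil1964, Chap. I n° 11] -/
theorem mem_comap_orthogonal_map_iff (U : Submodule ℂ (SchwartzBruhat X)) (f : SchwartzBruhat X) :
    f ∈ ((U.map (toLp ν))ᗮ).comap (toLp ν) ↔
      ∀ u ∈ U, ∫ x, conj ((u : X → ℂ) x) * (f : X → ℂ) x ∂ν = 0 := by
  rw [Submodule.mem_comap, Submodule.mem_orthogonal]
  constructor
  · intro h u hu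
    rw [← inner_toLp_toLp]
    exact h _ (Submodule.mem_map_of_mem hu)
  · rintro h _ ⟨u, hu, rfl⟩
    rw [inner_toLp_toLp]
    exact h u hu

/-- membership, inner-product form: `f ∈ U' ↔ ∀ u ∈ U, ⟪[u], [f]⟫ = 0`. [cite: Weil1964, Chap. I n° 11] -/
theorem mem_comap_orthogonal_map_iff_inner (U : Submodule ℂ (SchwartzBruhat X)) (f : SchwartzBruhat X) :
    f ∈ ((U.map (toLp ν))ᗮ).comap (toLp ν) ↔ ∀ u ∈ U, ⟪toLp ν u, toLp ν f⟫_ℂ = 0 := by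
  rw [Submodule.mem_comap, Submodule.mem_orthogonal]
  constructor
  · intro h u hu
    exact h _ (Submodule.mem_map_of_mem hu)
  · rintro h _ ⟨u, hu, rfl⟩
    exact h u hu

/-- **`U ⊓ U' = ⊥`**: the `L²` pairing is DEFINITE on `𝒮(X)` when `ν` charges non-empty open sets (`toLp_injective`,
i.e. `l2NormSq_pos`). [cite: Weil1964, Chap. I n° 11] -/
theorem inf_comap_orthogonal_map_eq_bot [ν.IsOpenPosMeasure] (U : Submodule ℂ (SchwartzBruhat X)) :
    U ⊓ ((U.map (toLp ν))ᗮ).comap (toLp ν) = ⊥ := by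
  rw [eq_bot_iff]
  intro f hf
  rw [Submodule.mem_bot]
  have h0 : ⟪toLp ν f, toLp ν f⟫_ℂ = 0 :=
    (mem_comap_orthogonal_map_iff_inner ν U f).1 hf.2 f hf.1
  apply toLp_injective ν
  rw [map_zero]
  exact inner_self_eq_zero.1 h0

section Invariant

variable {G : Type*} [Group G]

/-- **the `L²`-orthogonal of an invariant subspace is invariant under a CONFORMALLY `L²`-isometric action**: if
`‖ρ(g)Φ‖²_{L²} = c_g ‖Φ‖²_{L²}` for all `Φ` and `U` is `ρ`-invariant, then `f ∈ U' ⇒ ρ(g) f ∈ U'` —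
`⟪u, ρ(g)f⟫ = ⟪ρ(g)ρ(g⁻¹)u, ρ(g)f⟫ = c_g ⟪ρ(g⁻¹)u, f⟫ = 0` by polarization. [cite: Bump1997, Prop. 4.2.5] -/
theorem rho_mem_comap_orthogonal_map {ρ : Representation ℂ G (SchwartzBruhat X)}
    (hconf : ∀ g : G, ∃ c : ℝ≥0∞, ∀ Φ, l2NormSq ν (ρ g Φ) = c * l2NormSq ν Φ)
    {U : Submodule ℂ (SchwartzBruhat X)} (hUinv : ∀ g, ∀ u ∈ U, ρ g u ∈ U) (g : G)
    {f : SchwartzBruhat X} (hf : f ∈ ((U.map (toLp ν))ᗮ).comap (toLp ν)) :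
    ρ g f ∈ ((U.map (toLp ν))ᗮ).comap (toLp ν) := by
  rw [mem_comap_orthogonal_map_iff_inner] at hf ⊢
  intro u hu
  obtain ⟨c, hc⟩ := hconf g
  have hu' : u = ρ g (ρ g⁻¹ u) := by
    rw [← Module.End.mul_apply, ← map_mul, mul_inv_cancel, map_one, Module.End.one_apply]
  rw [hu', inner_toLp_map_map_of_l2NormSq_eq_mul ν (ρ g) hc, hf _ (hUinv g⁻¹ u hu), mul_zero]

/-- hence, for `f₁ ∈ U` and `f₂ ∈ U'`, **`⟪[ρ(g) f₁], [f₂]⟫ = 0` and `∫ conj (ρ(g) f₁) · f₂ dν = 0` for every `g`** (the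
form in which the complement is used in the doubling argument: matrix coefficients across `U ⊕ U'` vanish).
[cite: Bump1997, Prop. 4.2.5] -/
theorem integral_conj_rho_mul_eq_zero {ρ : Representation ℂ G (SchwartzBruhat X)}
    {U : Submodule ℂ (SchwartzBruhat X)} (hUinv : ∀ g, ∀ u ∈ U, ρ g u ∈ U) {f₁ f₂ : SchwartzBruhat X}
    (hf₁ : f₁ ∈ U) (hf₂ : f₂ ∈ ((U.map (toLp ν))ᗮ).comap (toLp ν)) (g : G) :
    ∫ x, conj ((ρ g f₁ : X → ℂ) x) * (f₂ : X → ℂ) x ∂ν = 0 :=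
  (mem_comap_orthogonal_map_iff ν U f₂).1 hf₂ _ (hUinv g f₁ hf₁)

end Invariant

/-! ## §3 `U ⊔ U' = ⊤` for admissible actions isometric on a compact open subgroup -/

section Admissible

variable {G : Type*} [Group G] [TopologicalSpace G] [IsTopologicalGroup G]

/-- **`U ⊔ U' = ⊤`: the `L²`-orthogonal of an invariant subspace of an ADMISSIBLE representation on `𝒮(X)`, isometric
for `‖·‖_{L²(ν)}` on a compact open subgroup `K`, is a complement.**  Unitarity is required on `K` only, and `U` need
only be `K`-invariant: the statement is the tree's `Unitary.sup_orthogonal_eq_top_of_isAdmissible` (whose proof uses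
`K` alone) transported to the inner product space `range (toLp ν) ≤ L²(X, ν)` — `K`-isometry of the norm is
`K`-unitarity of the inner product by `LinearMap.norm_map_iff_inner_map_map`, admissibility passes along the
equivariant `LinearEquiv.ofInjective (toLp ν)`, and `Semisimple.sup_orthogonal_eq_top_of_invariant` applies to `ρ|_K`
(`Unitary.finiteDimensional_span_range_restrict`, `Unitary.finiteDimensional_isotypicComponent_restrict`).
[cite: Bump1997, Prop. 4.2.5] -/
theorem sup_comap_orthogonal_map_eq_top_of_isAdmissible [ν.IsOpenPosMeasure]
    {ρ : Representation ℂ G (SchwartzBruhat X)} (K : OpenSubgroup G) (hK : IsCompact (K : Set G))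
    (hKiso : ∀ k ∈ K, ∀ Φ, l2NormSq ν (ρ k Φ) = l2NormSq ν Φ) (hadm : ρ.IsAdmissible)
    {U : Submodule ℂ (SchwartzBruhat X)} (hUinv : ∀ k ∈ K, ∀ u ∈ U, ρ k u ∈ U) :
    U ⊔ ((U.map (toLp ν))ᗮ).comap (toLp ν) = ⊤ := by
  -- the range of `toLp`, an inner product subspace of `L²(X, ν)`, and `e : 𝒮(X) ≃ V`
  set V : Submodule ℂ (Lp ℂ 2 ν) := LinearMap.range (toLp ν) with hV
  set e : SchwartzBruhat X ≃ₗ[ℂ] V := LinearEquiv.ofInjective (toLp ν) (toLp_injective ν) with he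
  have hecoe : ∀ Φ : SchwartzBruhat X, ((e Φ : V) : Lp ℂ 2 ν) = toLp ν Φ := fun Φ => rfl
  -- the transported representation `ρV g = e ∘ ρ g ∘ e⁻¹`
  set ρV : Representation ℂ G V :=
    (e.conjRingEquiv : Module.End ℂ (SchwartzBruhat X) ≃+* Module.End ℂ V).toMonoidHom.comp ρ with hρV
  have hρV_apply : ∀ (g : G) (v : V), ρV g v = e (ρ g (e.symm v)) := fun g v => rfl
  have hequiv : ∀ (g : G) (Φ : SchwartzBruhat X), e (ρ g Φ) = ρV g (e Φ) := fun g Φ => by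
    rw [hρV_apply, e.symm_apply_apply]
  -- admissible
  have hadmV : ρV.IsAdmissible := isAdmissible_of_equivariant ρV e hequiv hadm
  -- `K` acts unitarily on `V` (norm preservation ⇒ inner product preservation)
  have hKU : ∀ k ∈ K, ∀ v w : V, ⟪ρV k v, ρV k w⟫_ℂ = ⟪v, w⟫_ℂ := by
    intro k hk
    refine (LinearMap.norm_map_iff_inner_map_map (ρV k)).1 fun v => ?_
    obtain ⟨Φ, rfl⟩ := e.surjective v
    rw [← hequiv, Submodule.coe_norm, Submodule.coe_norm, hecoe, hecoe]
    exact norm_toLp_eq_of_l2NormSq_eq ν (hKiso k hk Φ)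
  -- `U_V := e(U)` is `K`-invariant
  set UV : Submodule ℂ V := U.map (e : SchwartzBruhat X →ₗ[ℂ] V) with hUV
  have hUVinv : ∀ k ∈ K, ∀ v ∈ UV, ρV k v ∈ UV := by
    rintro k hk _ ⟨u, hu, rfl⟩
    exact ⟨ρ k u, hUinv k hk u hu, hequiv k u⟩
  -- the abstract theorem on `ρV|_K`
  have hsup : UV ⊔ UVᗮ = ⊤ :=
    Literature.RepresentationTheory.Semisimple.sup_orthogonal_eq_top_of_invariant
      (ρ := (ρV.comp (K : Subgroup G).subtype : Representation ℂ (K : Subgroup G) V))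
      (fun k v w => hKU (k : G) k.2 v w)
      (Literature.RepresentationTheory.Unitary.finiteDimensional_span_range_restrict ρV K hK hadmV.isSmooth)
      (fun _ hc => Literature.RepresentationTheory.Unitary.finiteDimensional_isotypicComponent_restrict ρV K hK hadmV hc)
      (fun k v hv => hUVinv (k : G) k.2 v hv)
  -- pull back along `e`
  rw [eq_top_iff]
  intro f _
  have hf : e f ∈ UV ⊔ UVᗮ := by
    rw [hsup]
    exact Submodule.mem_top
  obtain ⟨a, ha, b, hb, hab⟩ := Submodule.mem_sup.1 hf
  obtain ⟨u, hu, hua'⟩ := ha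
  have hua : e u = a := hua'
  have hfb : f = u + e.symm b := by
    apply e.injective
    rw [map_add, e.apply_symm_apply, hua]
    exact hab.symm
  rw [hfb]
  refine Submodule.add_mem_sup hu ?_
  rw [mem_comap_orthogonal_map_iff_inner]
  intro u' hu'
  have hb' : ⟪(e u' : V), b⟫_ℂ = 0 :=
    (Submodule.mem_orthogonal _ _).1 hb _ ⟨u', hu', rfl⟩
  rw [← hecoe u', ← hecoe (e.symm b), e.apply_symm_apply, ← Submodule.coe_inner]
  exact hb'

/-! ## §4 Packaged: the invariant `L²`-orthogonal complement; complete reducibility -/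

/-- **`L²` orthogonal complements in `𝒮(X)` for conformally unitary admissible actions.**  Let `G` be a topological group
with a compact open subgroup `K`, `ρ` an ADMISSIBLE representation of `G` on `𝒮(X)` which is CONFORMALLY
`L²(ν)`-isometric (`‖ρ(g)Φ‖² = c_g ‖Φ‖²`, `0 < c_g < ∞`) and `L²(ν)`-isometric on `K` — the outputs of
`GelbartRogawski1991/LocalSplittingConformallyIsometric.lean` for local Weil representations.  Then every
`ρ`-invariant `U ≤ 𝒮(X)` has the `ρ`-invariant complement `U' = {f | ∀ u ∈ U, ∫ conj u · f dν = 0}`: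
`U ⊓ U' = ⊥`, `U ⊔ U' = ⊤`. [cite: Bump1997, Prop. 4.2.5] -/
theorem exists_orthogonal_compl_of_isAdmissible [ν.IsOpenPosMeasure] {ρ : Representation ℂ G (SchwartzBruhat X)}
    (K : OpenSubgroup G) (hK : IsCompact (K : Set G)) (hadm : ρ.IsAdmissible)
    (hconf : ∀ g : G, ∃ c : ℝ≥0∞, c ≠ 0 ∧ c ≠ ∞ ∧ ∀ Φ, l2NormSq ν (ρ g Φ) = c * l2NormSq ν Φ)
    (hKiso : ∀ k ∈ K, ∀ Φ, l2NormSq ν (ρ k Φ) = l2NormSq ν Φ)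
    (U : Submodule ℂ (SchwartzBruhat X)) (hUinv : ∀ g, ∀ u ∈ U, ρ g u ∈ U) :
    ∃ U' : Submodule ℂ (SchwartzBruhat X),
      (∀ f, f ∈ U' ↔ ∀ u ∈ U, ∫ x, conj ((u : X → ℂ) x) * (f : X → ℂ) x ∂ν = 0) ∧
      (∀ g, ∀ f ∈ U', ρ g f ∈ U') ∧ U ⊓ U' = ⊥ ∧ U ⊔ U' = ⊤ :=
  ⟨((U.map (toLp ν))ᗮ).comap (toLp ν), fun f => mem_comap_orthogonal_map_iff ν U f,
    fun g _ hf => rho_mem_comap_orthogonal_map ν (fun g' => (hconf g').imp fun _ hc => hc.2.2) hUinv g hf,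
    inf_comap_orthogonal_map_eq_bot ν U,
    sup_comap_orthogonal_map_eq_top_of_isAdmissible ν K hK hKiso hadm fun k _ => hUinv k⟩

/-- `IsCompl` form: `U` and its (invariant) `L²`-orthogonal are complements. [cite: Bump1997, Prop. 4.2.5] -/
theorem isCompl_comap_orthogonal_map_of_isAdmissible [ν.IsOpenPosMeasure]
    {ρ : Representation ℂ G (SchwartzBruhat X)} (K : OpenSubgroup G) (hK : IsCompact (K : Set G))
    (hKiso : ∀ k ∈ K, ∀ Φ, l2NormSq ν (ρ k Φ) = l2NormSq ν Φ) (hadm : ρ.IsAdmissible)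
    {U : Submodule ℂ (SchwartzBruhat X)} (hUinv : ∀ k ∈ K, ∀ u ∈ U, ρ k u ∈ U) :
    IsCompl U (((U.map (toLp ν))ᗮ).comap (toLp ν)) :=
  ⟨disjoint_iff.2 (inf_comap_orthogonal_map_eq_bot ν U),
    codisjoint_iff.2 (sup_comap_orthogonal_map_eq_top_of_isAdmissible ν K hK hKiso hadm hUinv)⟩

/-- **An admissible, conformally `L²`-isometric representation on `𝒮(X)`, isometric on a compact open subgroup, is
completely reducible** (Mathlib `Representation.IsSemisimpleRepresentation`: the lattice of subrepresentations is
complemented), the complement of `W` being its `L²`-orthogonal. [cite: Bump1997, Prop. 4.2.5] -/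
theorem isSemisimpleRepresentation_of_isAdmissible_of_conformal [ν.IsOpenPosMeasure]
    {ρ : Representation ℂ G (SchwartzBruhat X)} (K : OpenSubgroup G) (hK : IsCompact (K : Set G))
    (hadm : ρ.IsAdmissible)
    (hconf : ∀ g : G, ∃ c : ℝ≥0∞, c ≠ 0 ∧ c ≠ ∞ ∧ ∀ Φ, l2NormSq ν (ρ g Φ) = c * l2NormSq ν Φ)
    (hKiso : ∀ k ∈ K, ∀ Φ, l2NormSq ν (ρ k Φ) = l2NormSq ν Φ) : ρ.IsSemisimpleRepresentation := by
  refine ⟨fun W => ?_⟩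
  obtain ⟨U', -, hinv, hinf, hsup⟩ :=
    exists_orthogonal_compl_of_isAdmissible ν K hK hadm hconf hKiso W.toSubmodule W.apply_mem_toSubmodule
  refine ⟨⟨U', fun g _ hv => hinv g _ hv⟩, ?_, ?_⟩
  · rw [disjoint_iff]
    apply Subrepresentation.toSubmodule_injective
    exact hinf
  · rw [codisjoint_iff]
    apply Subrepresentation.toSubmodule_injective
    exact hsup

end Admissible

end SchwartzBruhat

end Literature.NumberTheory.Automorphic

end
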